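import Literature.NumberTheory.LFunctions.ClassGroupJointDenseness
import Literature.NumberTheory.LFunctions.ZetaUniversalityDiscProofs
import HarnessLib

/-!
# Joint universality for class group `L`-functions of an imaginary quadratic field — torus lemmas

Topic `Literature/NumberTheory/LFunctions` (namespace `Literature.NumberTheory.LFunctions.NumberField`,
sub-namespace `ClassGroupUniversality`).  Everything here is PROVED (two small definitions with
bodies, theorems; no named facts).

The torus side of Voronin's argument (Steuding §1.3 (1.22)–(1.26)) for the finite Euler products
`Z_P(s, χ) = ∏_{p<P} ∏_{𝔮∣p} (1 − χ(𝔮) N𝔮^{−s})⁻¹` of class group `L`-functions, in the first-order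
architecture of the tree's `ZetaUniversalityDiscTorus.lean` / `ZetaUniversalityDiscProofs.lean`:
the phase of a prime ideal `𝔮` with `N𝔮 = p^k` at a torus point `θ ∈ (ℝ/ℤ)^{primes<P}` is
`e(θ_p)^k` (`powPhase (phaseFn θ) (N𝔮)`), so that along the Kronecker flow `θ_p = −t log p/2π`
the twisted product is `Z_P(s + it, χ)` (`classEulerProduct_shift_eq_twisted`); the product splits
into a steering part (`p < N`) and a tail (`N ≤ p < P`) whose distance to `1` is controlled by
the first-order tail sum `Σ_{N≤q<P} a_χ(q) q^{−s} e(θ_q)` (`a_χ(q) = Σ_{N𝔮=q} χ(𝔮)`, `|a_χ| ≤ 2`)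
and `Σ q^{−2σ}` (`norm_tailProd_sub_one_le`), and the torus average of the weighted circle mean
square of the tail sum is `≤ 8π (Σ q^{−2σ₁}) ∫φ` (`integral_mul_circleMeanSquare_tailSum_le`).

## References

* [Steuding2007] J. Steuding, *Value-Distribution of L-Functions*, LNM 1877, §1.3–1.4,
  Thm. 1.10.
* [BayartMatheron2009] F. Bayart, É. Matheron, *Dynamics of Linear Operators*, §11.7.
* A. A. Karatsuba, S. M. Voronin, *The Riemann Zeta-Function*, de Gruyter 1992, Ch. VII §3.
-/

noncomputable section

open scoped NumberField nonZeroDivisors Real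
open NumberField Complex Filter Topology Set Metric MeasureTheory Finset
open Literature.NumberTheory.NumberFields (natPrimeUnder natPrimeUnder_prime liesOver_natPrimeUnder
  mem_primesOver_iff_natPrimeUnder)
open Literature.NumberTheory.LFunctions.VoroninTorus
open Literature.NumberTheory.LFunctions.VoroninTools
open Literature.NumberTheory.DiophantineApproximation Literature.Barriers.RiemannHypothesis.BohrCourant
open Literature.Barriers.RiemannHypothesis.ShiftsOnDiscs

namespace Literature.NumberTheory.LFunctions.NumberField

variable {K : Type*} [Field K] [NumberField K]

namespace ClassGroupUniversality

open ClassGroupJointDenseness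

/-! ### The local datum and the phases of a torus point -/

/-- The twisted local datum `z(𝔮) = χ(𝔮) · e_p^{k} · N𝔮^{−s}` (`N𝔮 = p^k`; the phase through
`powPhase e (N𝔮)`). [folklore] -/
abbrev zTerm (χ : ClassGroup (𝓞 K) →* ℂˣ) (e : ℕ → ℂ) (Q : Ideal (𝓞 K)) (s : ℂ) : ℂ :=
  classGroupCharIdealHom χ Q * powPhase e (Ideal.absNorm Q) * ((Ideal.absNorm Q : ℕ) : ℂ) ^ (-s)

/-- The phases of a torus point `θ ∈ (ℝ/ℤ)^{primes<P}` as a function on `ℕ` (`1` off the primes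
`< P`). [folklore] -/
def phaseFn {P : ℕ} (θ : UnitAddTorus ↥(P.primesBelow)) (n : ℕ) : ℂ :=
  if h : n ∈ P.primesBelow then fourier 1 (θ ⟨n, h⟩) else 1

variable {P N : ℕ}

omit [NumberField K] in
/-- `phaseFn θ n = e(θ_n)` on the coordinates. [folklore] -/
theorem phaseFn_of_mem (θ : UnitAddTorus ↥(P.primesBelow)) {n : ℕ} (hn : n ∈ P.primesBelow) :
    phaseFn θ n = fourier 1 (θ ⟨n, hn⟩) := by
  rw [phaseFn, dif_pos hn]

/-- `|phaseFn θ n| = 1`. [folklore] -/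
theorem norm_phaseFn (θ : UnitAddTorus ↥(P.primesBelow)) (n : ℕ) : ‖phaseFn θ n‖ = 1 := by
  unfold phaseFn
  split_ifs
  · exact norm_fourier_one _
  · exact norm_one

/-- `θ ↦ phaseFn θ n` is continuous. [folklore] -/
theorem continuous_phaseFn_apply (n : ℕ) :
    Continuous fun θ : UnitAddTorus ↥(P.primesBelow) ↦ phaseFn θ n := by
  unfold phaseFn
  split_ifs with h
  · exact (fourier 1).continuous.comp (continuous_apply _)
  · exact continuous_const

/-- `θ ↦ powPhase (phaseFn θ) m` is continuous. [folklore] -/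
theorem continuous_powPhase_phaseFn (m : ℕ) :
    Continuous fun θ : UnitAddTorus ↥(P.primesBelow) ↦ powPhase (phaseFn θ) m := by
  unfold powPhase
  exact (continuous_phaseFn_apply _).pow _

/-- Translating a coordinate `j ≠ n` does not change `phaseFn θ n`. [folklore] -/
theorem phaseFn_add_single [DecidableEq ↥(P.primesBelow)] (θ : UnitAddTorus ↥(P.primesBelow))
    {j : ↥(P.primesBelow)} {n : ℕ} (hjn : j.1 ≠ n) (a : UnitAddCircle) :
    phaseFn (θ + Pi.single j a) n = phaseFn θ n := by
  unfold phaseFn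
  split_ifs with h
  · have hne : (⟨n, h⟩ : ↥(P.primesBelow)) ≠ j := fun h' ↦ hjn (congrArg Subtype.val h').symm
    rw [Pi.add_apply, Pi.single_eq_of_ne hne, add_zero]
  · rfl

/-! ### Regrouping the Euler product by rational primes, and the shift along the flow -/

/-- **`Z_P(s, χ) = ∏_{p<P} ∏_{𝔮 ∣ p} (1 − χ(𝔮)N𝔮^{−s})⁻¹`** (regrouping `primesBelowIdeals K P`
by the rational prime below). [folklore] -/
theorem classEulerProduct_eq_prod_primesBelow (χ : ClassGroup (𝓞 K) →* ℂˣ) (P : ℕ) (s : ℂ) :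
    classEulerProduct K χ P s = ∏ p ∈ P.primesBelow, ∏ Q ∈ primesOverNat K p,
      (1 - classGroupCharIdealHom χ Q * ((Ideal.absNorm Q : ℕ) : ℂ) ^ (-s))⁻¹ := by
  classical
  rw [classEulerProduct]
  have hmaps : ∀ Q ∈ primesBelowIdeals K P, natPrimeUnder Q ∈ P.primesBelow := by
    intro Q hQ
    obtain ⟨h1, h2, h3⟩ := mem_primesBelowIdeals.mp hQ
    exact Nat.mem_primesBelow.mpr ⟨h3, natPrimeUnder_prime h1 h2⟩
  rw [← Finset.prod_fiberwise_of_maps_to hmaps]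
  refine Finset.prod_congr rfl fun p hp ↦ ?_
  have hpp : p.Prime := (Nat.mem_primesBelow.mp hp).2
  have hpP : p < P := (Nat.mem_primesBelow.mp hp).1
  congr 1
  ext Q
  rw [Finset.mem_filter, mem_primesBelowIdeals, mem_primesOverNat_iff hpp]
  constructor
  · rintro ⟨⟨h1, h2, -⟩, h4⟩; exact ⟨h1, h2, h4⟩
  · rintro ⟨h1, h2, h4⟩; exact ⟨⟨h1, h2, by rw [h4]; exact hpP⟩, h4⟩

/-- `(p^k)^{−it} = (p^{−it})^k` for natural `p ≥ 1`. [folklore] -/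
theorem natCast_pow_cpow (p k : ℕ) (hp : 0 < p) (w : ℂ) :
    (((p ^ k : ℕ)) : ℂ) ^ w = ((p : ℂ) ^ w) ^ k := by
  have hp0 : (p : ℂ) ≠ 0 := by exact_mod_cast hp.ne'
  have hpk0 : ((p ^ k : ℕ) : ℂ) ≠ 0 := by exact_mod_cast (pow_pos hp k).ne'
  rw [Complex.cpow_def_of_ne_zero hpk0, Complex.cpow_def_of_ne_zero hp0, ← Complex.exp_nat_mul]
  congr 1
  rw [Nat.cast_pow, show ((p : ℂ) ^ k) = (((p : ℝ) ^ k : ℝ) : ℂ) by push_cast; rfl,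
    show (p : ℂ) = ((p : ℝ) : ℂ) by rfl, ← Complex.ofReal_log (by positivity),
    ← Complex.ofReal_log (by positivity), Real.log_pow]
  push_cast
  ring

/-- Along the flow the phase of `𝔮 ∣ p` is `N𝔮^{−it}`: `powPhase (n ↦ n^{−it}) (N𝔮) = N𝔮^{−it}`.
[folklore] -/
theorem powPhase_cpow_eq {p : ℕ} (hp : p.Prime) {Q : Ideal (𝓞 K)} (hQ : Q ∈ primesOverNat K p)
    (t : ℝ) :
    powPhase (fun n : ℕ ↦ (n : ℂ) ^ (-((t : ℂ) * I))) (Ideal.absNorm Q) =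
      ((Ideal.absNorm Q : ℕ) : ℂ) ^ (-((t : ℂ) * I)) := by
  obtain ⟨k, -, hN, hph⟩ := powPhase_absNorm_of_mem_primesOverNat
    (fun n : ℕ ↦ (n : ℂ) ^ (-((t : ℂ) * I))) hp hQ
  rw [hph, hN, natCast_pow_cpow p k hp.pos]

/-- **The shifted Euler product is the twisted product along the flow**:
`Z_P(s + it, χ) = ∏_{p<P} ∏_{𝔮∣p} (1 − z(𝔮; (n ↦ n^{−it}), s))⁻¹`. [folklore] -/
theorem classEulerProduct_shift_eq_twisted (χ : ClassGroup (𝓞 K) →* ℂˣ) (P : ℕ) (s : ℂ) (t : ℝ) :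
    classEulerProduct K χ P (s + t * I) = ∏ p ∈ P.primesBelow, ∏ Q ∈ primesOverNat K p,
      (1 - zTerm χ (fun n : ℕ ↦ (n : ℂ) ^ (-((t : ℂ) * I))) Q s)⁻¹ := by
  rw [classEulerProduct_eq_prod_primesBelow]
  refine Finset.prod_congr rfl fun p hp ↦ Finset.prod_congr rfl fun Q hQ ↦ ?_
  have hpp : p.Prime := (Nat.mem_primesBelow.mp hp).2
  have hN0 : Ideal.absNorm Q ≠ 0 := by
    have := two_le_absNorm_of_mem_primesOverNat hpp hQ; omega
  rw [zTerm, powPhase_cpow_eq hpp hQ t,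
    natCast_cpow_neg_add_mul_I hN0 s t]
  ring

/-- The phase of `𝔮 ∣ p` only depends on `e_p`. [folklore] -/
theorem powPhase_congr {p : ℕ} (hp : p.Prime) {Q : Ideal (𝓞 K)} (hQ : Q ∈ primesOverNat K p)
    {e e' : ℕ → ℂ} (h : e p = e' p) :
    powPhase e (Ideal.absNorm Q) = powPhase e' (Ideal.absNorm Q) := by
  obtain ⟨k, hk, hN, -⟩ := powPhase_absNorm_of_mem_primesOverNat e hp hQ
  rw [powPhase, powPhase, hN, Nat.pow_minFac hk, hp.minFac_eq, h]

/-- The twisted products only see the phases at the primes of the index set. [folklore] -/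
theorem prod_twisted_congr (χ : ClassGroup (𝓞 K) →* ℂˣ) {M : Finset ℕ} (hM : ∀ p ∈ M, p.Prime)
    {e e' : ℕ → ℂ} (h : ∀ p ∈ M, e p = e' p) (s : ℂ) :
    ∏ p ∈ M, ∏ Q ∈ primesOverNat K p, (1 - zTerm χ e Q s)⁻¹ =
      ∏ p ∈ M, ∏ Q ∈ primesOverNat K p, (1 - zTerm χ e' Q s)⁻¹ := by
  refine Finset.prod_congr rfl fun p hp ↦ Finset.prod_congr rfl fun Q hQ ↦ ?_
  rw [zTerm, zTerm, powPhase_congr (hM p hp) hQ (h p hp)]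

/-- `phaseFn` of the flow point is the prime power: `phaseFn (flow t) n = n^{−it}` (`n < P` prime).
[folklore] -/
theorem phaseFn_flow (t : ℝ) {n : ℕ} (hn : n ∈ P.primesBelow) :
    phaseFn (fun q : ↥(P.primesBelow) ↦ (((t * (-Real.log q.1 / (2 * Real.pi))) : ℝ) : UnitAddCircle)) n =
      (n : ℂ) ^ (-((t : ℂ) * I)) := by
  rw [phaseFn_of_mem _ hn]
  exact fourier_one_flow_eq_cpow (Nat.prime_of_mem_primesBelow hn).ne_zero t

/-- **The Euler product along the flow, split into steering part and tail**: for `N ≤ P`,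
`Z_P(s + it, χ) = (∏_{p<N} ∏_{𝔮∣p} (1 − z(𝔮; θ_t, s))⁻¹) · (∏_{N≤q<P} ∏_{𝔮∣q} (1 − z(𝔮; θ_t, s))⁻¹)`
with `θ_t` the flow point. [cite: Steuding2007, §1.3 (1.22)] -/
theorem classEulerProduct_eq_steering_mul_tail (χ : ClassGroup (𝓞 K) →* ℂˣ) (hNP : N ≤ P)
    (s : ℂ) (t : ℝ) :
    classEulerProduct K χ P (s + t * I) =
      (∏ p ∈ N.primesBelow, ∏ Q ∈ primesOverNat K p, (1 - zTerm χ (phaseFn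
        (fun q : ↥(P.primesBelow) ↦ (((t * (-Real.log q.1 / (2 * Real.pi))) : ℝ) : UnitAddCircle)))
          Q s)⁻¹) *
      ∏ p ∈ (P.primesBelow).filter (fun n ↦ N ≤ n), ∏ Q ∈ primesOverNat K p, (1 - zTerm χ (phaseFn
        (fun q : ↥(P.primesBelow) ↦ (((t * (-Real.log q.1 / (2 * Real.pi))) : ℝ) : UnitAddCircle)))
          Q s)⁻¹ := by
  classical
  rw [classEulerProduct_shift_eq_twisted,
    prod_twisted_congr χ (fun p hp ↦ Nat.prime_of_mem_primesBelow hp)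
      (fun p hp ↦ (phaseFn_flow (P := P) t hp).symm) s]
  set F : ℕ → ℂ := fun p ↦ ∏ Q ∈ primesOverNat K p, (1 - zTerm χ (phaseFn
    (fun q : ↥(P.primesBelow) ↦ (((t * (-Real.log q.1 / (2 * Real.pi))) : ℝ) : UnitAddCircle))) Q s)⁻¹
    with hF
  change ∏ p ∈ P.primesBelow, F p = (∏ p ∈ N.primesBelow, F p) *
    ∏ p ∈ (P.primesBelow).filter (fun n ↦ N ≤ n), F p
  rw [← Finset.prod_union (disjoint_primesBelow_filter N P), ← primesBelow_eq_union hNP]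

/-! ### The tail: first-order sum and tail product -/

/-- The first-order tail sum `L(s; e) = Σ_{N≤q<P} e_q a_χ(q) q^{−s}`. [cite: Steuding2007, §1.3 (1.26)] -/
def tailSum (χ : ClassGroup (𝓞 K) →* ℂˣ) (N P : ℕ) (e : ℕ → ℂ) (s : ℂ) : ℂ :=
  ∑ q ∈ (P.primesBelow).filter (fun n ↦ N ≤ n), e q * aCoeff χ q * (q : ℂ) ^ (-s)

/-- The tail of squares `T(s) = Σ_{N≤q<P} q^{−2 Re s}`. [folklore] -/
def tailSq (N P : ℕ) (s : ℂ) : ℝ :=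
  ∑ q ∈ (P.primesBelow).filter (fun n ↦ N ≤ n), ((q : ℝ) ^ (-s.re)) ^ 2

omit [NumberField K] in
/-- `tailSq` is the subtype-indexed sum of the tree's torus lemmas. [folklore] -/
theorem tailSq_eq_sum_univ (N P : ℕ) (s : ℂ) :
    tailSq N P s = ∑ q ∈ (Finset.univ : Finset ↥(P.primesBelow)).filter (fun q ↦ N ≤ q.1),
      ((q.1 : ℝ) ^ (-s.re)) ^ 2 := by
  rw [tailSq, sum_univ_filter_coe (P.primesBelow) (fun n ↦ N ≤ n) (fun n ↦ ((n : ℝ) ^ (-s.re)) ^ 2)]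

omit [NumberField K] in
/-- `0 ≤ tailSq`. [folklore] -/
theorem tailSq_nonneg (N P : ℕ) (s : ℂ) : 0 ≤ tailSq N P s :=
  Finset.sum_nonneg fun _ _ ↦ sq_nonneg _

omit [NumberField K] in
/-- `((q^k))^{−σ} = (q^{−σ})^k` for naturals. [folklore] -/
theorem natCast_pow_rpow_neg (q k : ℕ) (σ : ℝ) :
    (((q ^ k : ℕ)) : ℝ) ^ (-σ) = ((q : ℝ) ^ (-σ)) ^ k := by
  rw [Nat.cast_pow, ← Real.rpow_natCast ((q : ℝ) ^ (-σ)), ← Real.rpow_mul (Nat.cast_nonneg _),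
    ← Real.rpow_natCast (q : ℝ), ← Real.rpow_mul (Nat.cast_nonneg _), mul_comm]

/-- **The tail product is close to `1`** (quadratic field, `N ≥ 4`, `Re s > 1/2`, unimodular
phases): if `‖L(s; e)‖ + 4 T(s) ≤ 1` then
`‖∏_{N≤q<P} ∏_{𝔮∣q} (1 − z(𝔮; e, s))⁻¹ − 1‖ ≤ 2‖L(s; e)‖ + 8 T(s)`
(`FiniteEulerPhases.norm_prod_inv_one_sub_sub_one_le` over the tail prime ideals; the degree-one
ideals give the first-order sum exactly, the degree-two ones and the squares are `≤ 2T` each).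
[cite: Steuding2007, §1.3 (1.25)–(1.26)] -/
theorem norm_tailProd_sub_one_le (h2 : Module.finrank ℚ K = 2) (χ : ClassGroup (𝓞 K) →* ℂˣ)
    (hN : 4 ≤ N) {s : ℂ} (hs : 1 / 2 < s.re) {e : ℕ → ℂ} (he : ∀ n, ‖e n‖ = 1)
    (hsmall : ‖tailSum χ N P e s‖ + 4 * tailSq N P s ≤ 1) :
    ‖(∏ q ∈ (P.primesBelow).filter (fun n ↦ N ≤ n), ∏ Q ∈ primesOverNat K q, (1 - zTerm χ e Q s)⁻¹) - 1‖ ≤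
      2 * ‖tailSum χ N P e s‖ + 8 * tailSq N P s := by
  classical
  set S' : Finset ℕ := (P.primesBelow).filter (fun n ↦ N ≤ n) with hS'
  have hS'p : ∀ q ∈ S', q.Prime ∧ N ≤ q := fun q hq ↦
    ⟨Nat.prime_of_mem_primesBelow (Finset.mem_filter.1 hq).1, (Finset.mem_filter.1 hq).2⟩
  set A : Finset (Σ _ : ℕ, Ideal (𝓞 K)) := S'.sigma (fun q ↦ primesOverNat K q) with hA
  set z : (Σ _ : ℕ, Ideal (𝓞 K)) → ℂ := fun x ↦ zTerm χ e x.2 s with hz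
  have hprod : (∏ q ∈ S', ∏ Q ∈ primesOverNat K q, (1 - zTerm χ e Q s)⁻¹) = ∏ x ∈ A, (1 - z x)⁻¹ := by
    rw [hA, Finset.prod_sigma]
  -- norms of the data
  have hzn : ∀ x ∈ A, ∃ k : ℕ, k ≠ 0 ∧ Ideal.absNorm x.2 = x.1 ^ k ∧
      ‖z x‖ ≤ ((x.1 : ℝ) ^ (-s.re)) ^ k := by
    intro x hx
    obtain ⟨hq, hQ⟩ := Finset.mem_sigma.1 hx
    obtain ⟨hqp, -⟩ := hS'p x.1 hq
    obtain ⟨k, hk, hNQ, -⟩ := powPhase_absNorm_of_mem_primesOverNat e hqp hQ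
    refine ⟨k, hk, hNQ, ?_⟩
    have hpos : 0 < x.1 ^ k := pow_pos hqp.pos k
    simp only [hz, zTerm, hNQ, norm_mul, norm_powPhase he, mul_one, Complex.norm_natCast_cpow_of_pos hpos,
      neg_re, natCast_pow_rpow_neg]
    calc ‖classGroupCharIdealHom χ x.2‖ * ((x.1 : ℝ) ^ (-s.re)) ^ k
        ≤ 1 * ((x.1 : ℝ) ^ (-s.re)) ^ k := by
          gcongr; exact norm_classGroupCharIdealHom_le χ _
      _ = ((x.1 : ℝ) ^ (-s.re)) ^ k := one_mul _
  have hq_le_half : ∀ q ∈ S', (q : ℝ) ^ (-s.re) ≤ 1 / 2 := fun q hq ↦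
    rpow_neg_le_half (hN.trans (hS'p q hq).2) hs
  have hq_nonneg : ∀ q : ℕ, 0 ≤ (q : ℝ) ^ (-s.re) := fun q ↦ Real.rpow_nonneg (Nat.cast_nonneg _) _
  -- `‖z x‖ ≤ 1/2`
  have hz_half : ∀ x ∈ A, ‖z x‖ ≤ 1 / 2 := by
    intro x hx
    obtain ⟨k, hk, -, hle⟩ := hzn x hx
    obtain ⟨hq, -⟩ := Finset.mem_sigma.1 hx
    refine hle.trans ((pow_le_pow_left₀ (hq_nonneg _) (hq_le_half x.1 hq) k).trans ?_)
    calc (1 / 2 : ℝ) ^ k ≤ (1 / 2 : ℝ) ^ 1 := pow_le_pow_of_le_one (by norm_num) (by norm_num)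
          (Nat.one_le_iff_ne_zero.mpr hk)
      _ = 1 / 2 := pow_one _
  -- `Σ ‖z‖² ≤ 2T`
  have hsq : ∑ x ∈ A, ‖z x‖ ^ 2 ≤ 2 * tailSq N P s := by
    rw [hA, Finset.sum_sigma, tailSq, Finset.mul_sum]
    refine Finset.sum_le_sum fun q hq ↦ ?_
    have hterm : ∀ Q ∈ primesOverNat K q, ‖z ⟨q, Q⟩‖ ^ 2 ≤ ((q : ℝ) ^ (-s.re)) ^ 2 := by
      intro Q hQ
      obtain ⟨k, hk, -, hle⟩ := hzn ⟨q, Q⟩ (Finset.mem_sigma.2 ⟨hq, hQ⟩)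
      refine pow_le_pow_left₀ (norm_nonneg _) (hle.trans ?_) 2
      calc ((q : ℝ) ^ (-s.re)) ^ k ≤ ((q : ℝ) ^ (-s.re)) ^ 1 :=
            pow_le_pow_of_le_one (hq_nonneg _) ((hq_le_half q hq).trans (by norm_num))
              (Nat.one_le_iff_ne_zero.mpr hk)
        _ = _ := pow_one _
    calc ∑ Q ∈ primesOverNat K q, ‖z ⟨q, Q⟩‖ ^ 2 ≤ ∑ _Q ∈ primesOverNat K q, ((q : ℝ) ^ (-s.re)) ^ 2 :=
          Finset.sum_le_sum hterm
      _ = (primesOverNat K q).card * ((q : ℝ) ^ (-s.re)) ^ 2 := by rw [Finset.sum_const, nsmul_eq_mul]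
      _ ≤ 2 * ((q : ℝ) ^ (-s.re)) ^ 2 := by
          gcongr; exact_mod_cast card_primesOverNat_le_two h2 (hS'p q hq).1
  -- `‖Σ z − L‖ ≤ 2T`
  have hlin : ‖(∑ x ∈ A, z x) - tailSum χ N P e s‖ ≤ 2 * tailSq N P s := by
    rw [hA, Finset.sum_sigma, tailSum, ← Finset.sum_sub_distrib, tailSq, Finset.mul_sum]
    refine (norm_sum_le _ _).trans (Finset.sum_le_sum fun q hq ↦ ?_)
    obtain ⟨hqp, hqN⟩ := hS'p q hq
    -- the degree-one ideals give the linear term exactly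
    have hlinq : e q * aCoeff χ q * (q : ℂ) ^ (-s) = ∑ Q ∈ primesOverNat K q,
        (if Ideal.absNorm Q = q then z ⟨q, Q⟩ else 0) := by
      rw [← Finset.sum_filter, ← idealsOfNorm_eq_filter hqp, aCoeff, twistCount, Finset.mul_sum,
        Finset.sum_mul]
      refine Finset.sum_congr rfl fun I hI ↦ ?_
      have hIq : Ideal.absNorm I = q := mem_idealsOfNorm.mp hI
      have hph : powPhase e q = e q := by
        have := powPhase_prime_pow e hqp one_ne_zero
        rwa [pow_one, pow_one] at this
      simp only [hz, zTerm, hIq, hph]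
      ring
    rw [hlinq, ← Finset.sum_sub_distrib]
    refine (norm_sum_le _ _).trans ?_
    have hterm : ∀ Q ∈ primesOverNat K q, ‖z ⟨q, Q⟩ - (if Ideal.absNorm Q = q then z ⟨q, Q⟩ else 0)‖ ≤
        ((q : ℝ) ^ (-s.re)) ^ 2 := by
      intro Q hQ
      by_cases hdeg : Ideal.absNorm Q = q
      · rw [if_pos hdeg, sub_self, norm_zero]; positivity
      · rw [if_neg hdeg, sub_zero]
        obtain ⟨k, hk, hNQ, hle⟩ := hzn ⟨q, Q⟩ (Finset.mem_sigma.2 ⟨hq, hQ⟩)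
        have hk2 : 2 ≤ k := by
          rcases Nat.lt_or_ge k 2 with h | h
          · interval_cases k
            · exact absurd rfl hk
            · simp only [pow_one] at hNQ; exact absurd hNQ hdeg
          · exact h
        refine hle.trans ?_
        exact pow_le_pow_of_le_one (hq_nonneg _) ((hq_le_half q hq).trans (by norm_num)) hk2
    calc ∑ Q ∈ primesOverNat K q, ‖z ⟨q, Q⟩ - (if Ideal.absNorm Q = q then z ⟨q, Q⟩ else 0)‖
        ≤ ∑ _Q ∈ primesOverNat K q, ((q : ℝ) ^ (-s.re)) ^ 2 := Finset.sum_le_sum hterm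
      _ = (primesOverNat K q).card * ((q : ℝ) ^ (-s.re)) ^ 2 := by rw [Finset.sum_const, nsmul_eq_mul]
      _ ≤ 2 * ((q : ℝ) ^ (-s.re)) ^ 2 := by
          gcongr; exact_mod_cast card_primesOverNat_le_two h2 hqp
  have hsumz : ‖∑ x ∈ A, z x‖ ≤ ‖tailSum χ N P e s‖ + 2 * tailSq N P s := by
    have := norm_add_le ((∑ x ∈ A, z x) - tailSum χ N P e s) (tailSum χ N P e s)
    rw [sub_add_cancel] at this
    linarith
  have hsmall' : ‖∑ x ∈ A, z x‖ + ∑ x ∈ A, ‖z x‖ ^ 2 ≤ 1 := by linarith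
  have h := FiniteEulerPhases.norm_prod_inv_one_sub_sub_one_le A hz_half hsmall'
  rw [hprod]
  linarith

/-! ### The tail sum on the torus: continuity, Cauchy transfer, torus mean square -/

/-- With the phases of a torus point, the tail sum is a character sum on the torus:
`L(s; phaseFn θ) = Σ_{q∈S} (a_χ(q) q^{−s}) e(θ_q)`, `S = {q : N ≤ q}`. [folklore] -/
theorem tailSum_phaseFn_eq (χ : ClassGroup (𝓞 K) →* ℂˣ) (θ : UnitAddTorus ↥(P.primesBelow)) (s : ℂ) :
    tailSum χ N P (phaseFn θ) s = ∑ q ∈ (Finset.univ : Finset ↥(P.primesBelow)).filter (fun q ↦ N ≤ q.1),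
      (aCoeff χ q.1 * (q.1 : ℂ) ^ (-s)) * fourier 1 (θ q) := by
  classical
  rw [tailSum, ← sum_univ_filter_coe (P.primesBelow) (fun n ↦ N ≤ n)
    (fun n ↦ phaseFn θ n * aCoeff χ n * (n : ℂ) ^ (-s))]
  refine Finset.sum_congr rfl fun q _ ↦ ?_
  rw [phaseFn_of_mem θ q.2]
  ring

/-- The torus tail sum `(s, θ) ↦ Σ_{q∈S} a_χ(q) q^{−s} e(θ_q)` is jointly continuous. [folklore] -/
theorem continuous_tailSumT (χ : ClassGroup (𝓞 K) →* ℂˣ) (S : Finset ↥(P.primesBelow)) :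
    Continuous fun p : ℂ × UnitAddTorus ↥(P.primesBelow) ↦
      ∑ q ∈ S, (aCoeff χ q.1 * (q.1 : ℂ) ^ (-p.1)) * fourier 1 (p.2 q) := by
  refine continuous_finsetSum _ fun q _ ↦ ?_
  have hq : (q.1 : ℂ) ≠ 0 := by exact_mod_cast (Nat.prime_of_mem_primesBelow q.2).ne_zero
  exact (continuous_const.mul (Continuous.const_cpow (continuous_fst.neg) (Or.inl hq))).mul
    ((fourier 1).continuous.comp ((continuous_apply q).comp continuous_snd))

/-- The circle mean square of the torus tail sum is continuous on the torus. [folklore] -/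
theorem continuous_circleMeanSquare_tailSumT (χ : ClassGroup (𝓞 K) →* ℂˣ)
    (S : Finset ↥(P.primesBelow)) (c : ℂ) (ρ' : ℝ) :
    Continuous fun θ : UnitAddTorus ↥(P.primesBelow) ↦
      ∫ α in (0 : ℝ)..2 * π, ‖∑ q ∈ S, (aCoeff χ q.1 * (q.1 : ℂ) ^ (-circleMap c ρ' α)) *
        fourier 1 (θ q)‖ ^ 2 := by
  refine intervalIntegral.continuous_parametric_intervalIntegral_of_continuous' ?_ _ _
  have h := (continuous_tailSumT χ S).comp
    (((continuous_circleMap c ρ').comp continuous_snd).prodMk continuous_fst :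
      Continuous fun p : UnitAddTorus ↥(P.primesBelow) × ℝ ↦ (circleMap c ρ' p.2, p.1))
  exact (continuous_norm.comp h).pow 2

/-- Cauchy transfer: the sup of the tail sum on `|s − c| ≤ ρ` is controlled by its circle mean
square on `|s − c| = ρ'`. [cite: Steuding2007, §1.3 (1.26)] -/
theorem norm_sq_tailSumT_le (χ : ClassGroup (𝓞 K) →* ℂˣ) (S : Finset ↥(P.primesBelow)) {c : ℂ}
    {ρ ρ' : ℝ} (hρ : 0 ≤ ρ) (hρρ' : ρ < ρ') (θ : UnitAddTorus ↥(P.primesBelow)) {s : ℂ}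
    (hs : s ∈ closedBall c ρ) :
    ‖∑ q ∈ S, (aCoeff χ q.1 * (q.1 : ℂ) ^ (-s)) * fourier 1 (θ q)‖ ^ 2 ≤
      ρ' ^ 2 / (2 * π * (ρ' - ρ) ^ 2) * ∫ α in (0 : ℝ)..2 * π,
        ‖∑ q ∈ S, (aCoeff χ q.1 * (q.1 : ℂ) ^ (-circleMap c ρ' α)) * fourier 1 (θ q)‖ ^ 2 := by
  have hd : Differentiable ℂ fun z : ℂ ↦
      ∑ q ∈ S, (aCoeff χ q.1 * (q.1 : ℂ) ^ (-z)) * fourier 1 (θ q) := by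
    refine Differentiable.fun_sum fun q _ ↦ ?_
    have hq : (q.1 : ℂ) ≠ 0 := by exact_mod_cast (Nat.prime_of_mem_primesBelow q.2).ne_zero
    exact ((differentiable_id.neg.const_cpow (Or.inl hq)).const_mul _).mul_const _
  exact norm_sq_le_mul_integral_norm_sq_circle hρ hρρ' hd.diffContOnCl hs

/-- **Torus average of the weighted circle mean square of the tail sum** (quadratic field): for a
continuous weight `φ ≥ 0` invariant under the coordinates in `S` and `Re ≥ σ₁` on the circle,
`∫ φ(θ) ∫₀^{2π} |L(c + ρ'e^{iα}; θ)|² dα dθ ≤ 2π · 4 (Σ_{q∈S} q^{−2σ₁}) ∫φ` (orthogonality of the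
characters `e(θ_q)`, `|a_χ(q)|² ≤ 4`). [cite: Steuding2007, §1.3 (1.24)] -/
theorem integral_mul_circleMeanSquare_tailSum_le (h2 : Module.finrank ℚ K = 2)
    (χ : ClassGroup (𝓞 K) →* ℂˣ) (S : Finset ↥(P.primesBelow))
    {φ : UnitAddTorus ↥(P.primesBelow) → ℝ} (hφc : Continuous φ)
    (hφ : ∀ j ∈ S, ∀ (x : UnitAddTorus ↥(P.primesBelow)) (a : UnitAddCircle),
      φ (x + Pi.single j a) = φ x)
    (hφ0 : ∀ θ, 0 ≤ φ θ) (c : ℂ) (ρ' : ℝ) {σ₁ : ℝ} (hσ₁ : ∀ α, σ₁ ≤ (circleMap c ρ' α).re) :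
    ∫ θ : UnitAddTorus ↥(P.primesBelow), φ θ *
        ∫ α in (0 : ℝ)..2 * π, ‖∑ q ∈ S, (aCoeff χ q.1 * (q.1 : ℂ) ^ (-circleMap c ρ' α)) *
          fourier 1 (θ q)‖ ^ 2 ≤
      2 * π * (4 * ∑ q ∈ S, ((q.1 : ℝ) ^ (-σ₁)) ^ 2) * ∫ θ : UnitAddTorus ↥(P.primesBelow), φ θ := by
  classical
  -- pull the weight inside and swap the integrals
  have e1 : ∀ θ : UnitAddTorus ↥(P.primesBelow), φ θ *
      ∫ α in (0 : ℝ)..2 * π, ‖∑ q ∈ S, (aCoeff χ q.1 * (q.1 : ℂ) ^ (-circleMap c ρ' α)) *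
        fourier 1 (θ q)‖ ^ 2 =
      ∫ α in (0 : ℝ)..2 * π, φ θ * ‖∑ q ∈ S, (aCoeff χ q.1 * (q.1 : ℂ) ^ (-circleMap c ρ' α)) *
        fourier 1 (θ q)‖ ^ 2 :=
    fun θ ↦ (intervalIntegral.integral_const_mul _ _).symm
  simp_rw [e1]
  have hFc : Continuous (Function.uncurry fun (α : ℝ) (θ : UnitAddTorus ↥(P.primesBelow)) ↦
      φ θ * ‖∑ q ∈ S, (aCoeff χ q.1 * (q.1 : ℂ) ^ (-circleMap c ρ' α)) * fourier 1 (θ q)‖ ^ 2) := by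
    have h := (continuous_tailSumT χ S).comp
      (((continuous_circleMap c ρ').comp continuous_fst).prodMk continuous_snd :
        Continuous fun p : ℝ × UnitAddTorus ↥(P.primesBelow) ↦ (circleMap c ρ' p.1, p.2))
    exact (hφc.comp continuous_snd).mul ((continuous_norm.comp h).pow 2)
  rw [integral_intervalIntegral_swap hFc (by positivity)]
  -- orthogonality on each circle point
  have e2 : ∀ α : ℝ, ∫ θ : UnitAddTorus ↥(P.primesBelow),
      φ θ * ‖∑ q ∈ S, (aCoeff χ q.1 * (q.1 : ℂ) ^ (-circleMap c ρ' α)) * fourier 1 (θ q)‖ ^ 2 =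
      (∑ q ∈ S, ‖aCoeff χ q.1 * (q.1 : ℂ) ^ (-circleMap c ρ' α)‖ ^ 2) *
        ∫ θ : UnitAddTorus ↥(P.primesBelow), φ θ :=
    fun α ↦ integral_mul_norm_sq_sum_fourier_complex S _ hφc hφ
  simp_rw [e2]
  -- monotonicity in `α`
  have hI0 : 0 ≤ ∫ θ : UnitAddTorus ↥(P.primesBelow), φ θ := integral_nonneg hφ0
  have hle : ∀ α ∈ Icc (0 : ℝ) (2 * π),
      (∑ q ∈ S, ‖aCoeff χ q.1 * (q.1 : ℂ) ^ (-circleMap c ρ' α)‖ ^ 2) *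
        ∫ θ : UnitAddTorus ↥(P.primesBelow), φ θ ≤
      (4 * ∑ q ∈ S, ((q.1 : ℝ) ^ (-σ₁)) ^ 2) * ∫ θ : UnitAddTorus ↥(P.primesBelow), φ θ := by
    intro α _
    refine mul_le_mul_of_nonneg_right ?_ hI0
    rw [Finset.mul_sum]
    refine Finset.sum_le_sum fun q _ ↦ ?_
    have hqp := Nat.prime_of_mem_primesBelow q.2
    have hq0 : q.1 ≠ 0 := hqp.ne_zero
    have hq1 : (1 : ℝ) ≤ q.1 := by exact_mod_cast hqp.one_lt.le
    rw [norm_mul, norm_natCast_cpow_neg hq0, mul_pow]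
    have ha : ‖aCoeff χ q.1‖ ^ 2 ≤ 4 := by
      have := norm_aCoeff_le h2 χ hqp
      nlinarith [norm_nonneg (aCoeff χ q.1)]
    have hb : ((q.1 : ℝ) ^ (-(circleMap c ρ' α).re)) ^ 2 ≤ ((q.1 : ℝ) ^ (-σ₁)) ^ 2 :=
      pow_le_pow_left₀ (by positivity)
        (Real.rpow_le_rpow_of_exponent_le hq1 (neg_le_neg (hσ₁ α))) 2
    exact mul_le_mul ha hb (by positivity) (by norm_num)
  have hcont : Continuous fun α : ℝ ↦
      (∑ q ∈ S, ‖aCoeff χ q.1 * (q.1 : ℂ) ^ (-circleMap c ρ' α)‖ ^ 2) *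
        ∫ θ : UnitAddTorus ↥(P.primesBelow), φ θ := by
    refine Continuous.mul (continuous_finsetSum _ fun q _ ↦ ?_) continuous_const
    have hq : (q.1 : ℂ) ≠ 0 := by exact_mod_cast (Nat.prime_of_mem_primesBelow q.2).ne_zero
    exact (continuous_norm.comp (continuous_const.mul
      (Continuous.const_cpow (continuous_circleMap c ρ').neg (Or.inl hq)))).pow 2
  calc ∫ α in (0 : ℝ)..2 * π, (∑ q ∈ S, ‖aCoeff χ q.1 * (q.1 : ℂ) ^ (-circleMap c ρ' α)‖ ^ 2) *
        ∫ θ : UnitAddTorus ↥(P.primesBelow), φ θ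
      ≤ ∫ α in (0 : ℝ)..2 * π, (4 * ∑ q ∈ S, ((q.1 : ℝ) ^ (-σ₁)) ^ 2) *
        ∫ θ : UnitAddTorus ↥(P.primesBelow), φ θ :=
        intervalIntegral.integral_mono_on (by positivity) (hcont.intervalIntegrable _ _)
          intervalIntegrable_const hle
    _ = 2 * π * (4 * ∑ q ∈ S, ((q.1 : ℝ) ^ (-σ₁)) ^ 2) * ∫ θ : UnitAddTorus ↥(P.primesBelow), φ θ := by
        rw [intervalIntegral.integral_const, smul_eq_mul]; ring

/-! ### The steering product on the fixed torus -/

/-- The steering product `Z_N(s, θ; χ) = ∏_{p<N} ∏_{𝔮∣p} (1 − z(𝔮; phaseFn θ, s))⁻¹` is jointly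
continuous on `{Re s > 0} × (ℝ/ℤ)^{primes<N}` (hence on closed discs in the strip). [folklore] -/
theorem continuousOn_steeringProd (χ : ClassGroup (𝓞 K) →* ℂˣ) (N : ℕ) {c : ℂ} {ρ : ℝ}
    (hre : ∀ s ∈ closedBall c ρ, 0 < s.re) :
    ContinuousOn (fun p : ℂ × UnitAddTorus ↥(N.primesBelow) ↦
      ∏ q ∈ N.primesBelow, ∏ Q ∈ primesOverNat K q, (1 - zTerm χ (phaseFn p.2) Q p.1)⁻¹)
      (closedBall c ρ ×ˢ univ) := by
  refine continuousOn_finsetProd _ fun q hq ↦ continuousOn_finsetProd _ fun Q hQ ↦ ?_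
  have hqp : q.Prime := Nat.prime_of_mem_primesBelow hq
  have hN2 := two_le_absNorm_of_mem_primesOverNat hqp hQ
  have hN0 : ((Ideal.absNorm Q : ℕ) : ℂ) ≠ 0 := by exact_mod_cast (by omega : Ideal.absNorm Q ≠ 0)
  have hc1 : Continuous fun p : ℂ × UnitAddTorus ↥(N.primesBelow) ↦
      (1 : ℂ) - zTerm χ (phaseFn p.2) Q p.1 := by
    refine continuous_const.sub ?_
    exact ((continuous_const.mul ((continuous_powPhase_phaseFn _).comp continuous_snd)).mul
      (Continuous.const_cpow continuous_fst.neg (Or.inl hN0)))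
  refine hc1.continuousOn.inv₀ fun p hp ↦ ?_
  exact one_sub_zTerm_ne_zero χ (norm_powPhase (norm_phaseFn p.2) _).le hqp hQ (hre p.1 hp.1)

/-! ### `L(s, χ) − Z_P(s, χ)` on the strip and on circles -/

/-- `Z_P(·, χ)` is differentiable at every `z` with `Re z > 0`. [folklore] -/
theorem differentiableAt_classEulerProduct (χ : ClassGroup (𝓞 K) →* ℂˣ) (P : ℕ) {z : ℂ}
    (hz : 0 < z.re) : DifferentiableAt ℂ (classEulerProduct K χ P) z := by
  unfold classEulerProduct
  refine DifferentiableAt.fun_finsetProd fun Q hQ ↦ DifferentiableAt.inv ?_ ?_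
  · have hQp := prime_of_mem_primesBelowIdeals hQ
    have hN0 : ((Ideal.absNorm Q : ℕ) : ℂ) ≠ 0 := by
      have := two_le_absNorm_of_prime hQp
      exact_mod_cast (by omega : Ideal.absNorm Q ≠ 0)
    exact (differentiableAt_const _).sub
      ((differentiableAt_id.neg.const_cpow (Or.inl hN0)).const_mul _)
  · obtain ⟨h1, h2', h3⟩ := mem_primesBelowIdeals.mp hQ
    have hqp := natPrimeUnder_prime h1 h2'
    have hQ' : Q ∈ primesOverNat K (natPrimeUnder Q) := (mem_primesOverNat_iff hqp).mpr ⟨h1, h2', rfl⟩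
    have := one_sub_zTerm_ne_zero χ (e := 1) (by simp) hqp hQ' hz
    simpa using this

/-- `L(z, χ) − Z_P(z, χ)` is holomorphic on the open strip `1/2 < Re z < 1`. [folklore] -/
theorem differentiableOn_L_sub_classEulerProduct_strip (χ : ClassGroup (𝓞 K) →* ℂˣ) (P : ℕ) :
    DifferentiableOn ℂ (fun z ↦ classGroupLFunction K χ z - classEulerProduct K χ P z)
      {z : ℂ | 1 / 2 < z.re ∧ z.re < 1} := by
  intro z hz
  have hne : z ≠ 1 := by intro h; rw [h] at hz; norm_num at hz
  exact ((differentiableAt_classGroupLFunction χ hne).sub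
    (differentiableAt_classEulerProduct χ P (by linarith [hz.1]))).differentiableWithinAt

/-- `L(z + it, χ) − Z_P(z + it, χ)` is holomorphic on closed discs inside the strip. [folklore] -/
theorem differentiableOn_L_sub_classEulerProduct (χ : ClassGroup (𝓞 K) →* ℂˣ) {c : ℂ} {ρ' : ℝ}
    (h1 : 1 / 2 < c.re - ρ') (h2' : c.re + ρ' < 1) (P : ℕ) (t : ℝ) :
    DifferentiableOn ℂ (fun z ↦ classGroupLFunction K χ (z + t * I) -
      classEulerProduct K χ P (z + t * I)) (closedBall c ρ') := by
  have hmaps : MapsTo (fun z : ℂ ↦ z + t * I) (closedBall c ρ') {z : ℂ | 1 / 2 < z.re ∧ z.re < 1} := by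
    intro z hz
    obtain ⟨ha, hb⟩ := abs_le.1 (VoroninAssembly.abs_re_sub_re_le_of_mem_closedBall hz)
    simp only [mem_setOf_eq, add_re, mul_I_re, ofReal_im, neg_zero, add_zero]
    exact ⟨by linarith, by linarith⟩
  exact (differentiableOn_L_sub_classEulerProduct_strip χ P).comp
    ((differentiable_id.add_const _).differentiableOn) hmaps

/-- Cauchy transfer for `L − Z_P`: sup on `|s − c| ≤ ρ` versus circle mean square on
`|s − c| = ρ'`. [cite: Steuding2007, §1.3 (1.21)] -/
theorem norm_sq_L_sub_classEulerProduct_le (χ : ClassGroup (𝓞 K) →* ℂˣ) {c : ℂ} {ρ ρ' : ℝ}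
    (hρ : 0 ≤ ρ) (hρρ' : ρ < ρ') (h1 : 1 / 2 < c.re - ρ') (h2' : c.re + ρ' < 1) (P : ℕ) (t : ℝ)
    {s : ℂ} (hs : s ∈ closedBall c ρ) :
    ‖classGroupLFunction K χ (s + t * I) - classEulerProduct K χ P (s + t * I)‖ ^ 2 ≤
      ρ' ^ 2 / (2 * π * (ρ' - ρ) ^ 2) * ∫ α in (0 : ℝ)..2 * π,
        ‖classGroupLFunction K χ (circleMap c ρ' α + t * I) -
          classEulerProduct K χ P (circleMap c ρ' α + t * I)‖ ^ 2 := by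
  have hd := (differentiableOn_L_sub_classEulerProduct χ h1 h2' P t).mono
    (closure_ball_subset_closedBall : closure (ball c ρ') ⊆ closedBall c ρ')
  exact norm_sq_le_mul_integral_norm_sq_circle hρ hρρ' hd.diffContOnCl hs

/-- Joint continuity in `(t, α)` of the circle integrand of `L − Z_P`. [folklore] -/
theorem continuous_L_sub_classEulerProduct_circle (χ : ClassGroup (𝓞 K) →* ℂˣ) {c : ℂ} {ρ' : ℝ}
    (hρ' : 0 ≤ ρ') (h1 : 1 / 2 < c.re - ρ') (h2' : c.re + ρ' < 1) (P : ℕ) :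
    Continuous (Function.uncurry fun (t α : ℝ) ↦ ‖classGroupLFunction K χ (circleMap c ρ' α + t * I) -
      classEulerProduct K χ P (circleMap c ρ' α + t * I)‖ ^ 2) := by
  have hcont := (differentiableOn_L_sub_classEulerProduct_strip χ P).continuousOn
  have hmap : Continuous fun p : ℝ × ℝ ↦ circleMap c ρ' p.2 + p.1 * I :=
    ((continuous_circleMap c ρ').comp continuous_snd).add
      ((Complex.continuous_ofReal.comp continuous_fst).mul continuous_const)
  have hin : ∀ p : ℝ × ℝ, circleMap c ρ' p.2 + p.1 * I ∈ {z : ℂ | 1 / 2 < z.re ∧ z.re < 1} := by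
    intro p
    have hz : circleMap c ρ' p.2 ∈ closedBall c ρ' :=
      sphere_subset_closedBall (circleMap_mem_sphere c hρ' p.2)
    obtain ⟨ha, hb⟩ := abs_le.1 (VoroninAssembly.abs_re_sub_re_le_of_mem_closedBall hz)
    simp only [mem_setOf_eq, add_re, mul_I_re, ofReal_im, neg_zero, add_zero]
    exact ⟨by linarith, by linarith⟩
  have h := hcont.comp_continuous hmap hin
  exact (continuous_norm.comp h).pow 2

/-! ### The three-epsilon step at a good shift -/

/-- **Three epsilons**: if `‖Z − g‖ < ε/4`, `‖g‖ ≤ M`, `‖Q − 1‖ ≤ 10 δ₁`, `(M+1)·10δ₁ ≤ ε/4`,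
`ε ≤ 1` and `‖L − Z Q‖ < ε/4`, then `‖L − g‖ < ε`. [cite: Steuding2007, §1.3 (1.26) and sequel] -/
theorem norm_sub_lt_of_three_eps {Lv Z Q g : ℂ} {M δ₁ ε : ℝ} (hKδ : (M + 1) * (10 * δ₁) ≤ ε / 4)
    (hM : ‖g‖ ≤ M) (hZg : ‖Z - g‖ < ε / 4) (hQ : ‖Q - 1‖ ≤ 10 * δ₁) (hε : 0 < ε) (hε1 : ε ≤ 1)
    (hLZ : ‖Lv - Z * Q‖ < ε / 4) : ‖Lv - g‖ < ε := by
  have h1 := norm_le_insert' Z g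
  have hδ0 : 0 ≤ 10 * δ₁ := (norm_nonneg _).trans hQ
  have hM0 : 0 ≤ M := (norm_nonneg _).trans hM
  -- `‖Z (Q − 1)‖ ≤ (‖g‖ + ε/4) · 10δ₁ ≤ (M + 1)·10δ₁ + (ε/4)·10δ₁`; use `(M+1)10δ₁ ≤ ε/4 ≤ ...`
  have hZQ : ‖Z * Q - Z‖ ≤ (M + ε / 4) * (10 * δ₁) := by
    rw [show Z * Q - Z = Z * (Q - 1) by ring, norm_mul]
    exact mul_le_mul (by linarith) hQ (norm_nonneg _) (by positivity)
  -- `10δ₁ ≤ (ε/4)/(M+1) ≤ ε/4`, so `(ε/4)·10δ₁ ≤ (ε/4)·(ε/4)/(M+1)`; we simply bound using `hKδ` twice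
  have hδε : 10 * δ₁ ≤ ε / 4 := by
    have : (M + 1) * (10 * δ₁) ≥ 1 * (10 * δ₁) := by gcongr; linarith
    linarith
  have hZQ' : ‖Z * Q - Z‖ ≤ ε / 4 + ε / 4 * (ε / 4) := by
    calc ‖Z * Q - Z‖ ≤ (M + ε / 4) * (10 * δ₁) := hZQ
      _ = M * (10 * δ₁) + ε / 4 * (10 * δ₁) := by ring
      _ ≤ (M + 1) * (10 * δ₁) + ε / 4 * (ε / 4) := by gcongr; linarith
      _ ≤ ε / 4 + ε / 4 * (ε / 4) := by linarith
  calc ‖Lv - g‖ = ‖(Lv - Z * Q) + (Z * Q - Z) + (Z - g)‖ := by ring_nf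
    _ ≤ ‖Lv - Z * Q‖ + ‖Z * Q - Z‖ + ‖Z - g‖ := norm_add₃_le
    _ < ε / 4 + (ε / 4 + ε / 4 * (ε / 4)) + ε / 4 := by linarith
    _ ≤ ε := by nlinarith

end ClassGroupUniversality

end Literature.NumberTheory.LFunctions.NumberField
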